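import Summits.QuantumFields.YangMills.Theorems.BalabanLadderIRTwistedSlabZeroFormGap
import Mathlib.Analysis.SpecialFunctions.Trigonometric.DerivHyp
import HarnessLib

/-!
# Uniform propagator decay on the twisted tube: a Combes–Thomas a-priori estimate for the adjoint covariant Laplacian at the
# twist-eating ladder, with constants INDEPENDENT of the long extents `L, t` (the M4 brick (m3) of the T1 anatomy)

HELPER toward stub **T1** `TwistedSlabAnchor` of LINE `twisted-slab-continuity` (crux `IRcof`, stmt-QuantumFields-26930, census row 43;
LEAD prover ym-ir-line-tsc-p1 g6; `--supports` the crux, `--as helper`).  Theorems only.  K43 of the T1 programme; memo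
`Cruxes/IRcof/T1-ANATOMY-tsc-p1.md` §16.3 (m3): every weak-coupling cluster expansion of the twisted tube starts from the Gaussian step, whose
covariance is the inverse of the adjoint covariant Laplacian `Δ_U = Σ_μ ∇⁺_μ† ∇⁺_μ` on traceless colour fields at a twist-eating background `U`
(the Faddeev–Popov operator of the background Lorenz gauge; by K3b's Weitzenböck identity also the Feynman-gauge gluon operator, componentwise);
the expansion needs `|Δ_U⁻¹(x,y)| ≤ K e^{−θ d(x,y)}` with `K, θ` UNIFORM in the long extents.  K3c (`zeroForm_gap_ladder`) gives the gap
`g = 4sin²(π∕(Nℓ₀))` uniformly in `L, t`; this file turns the uniform GAP into uniform EXPONENTIAL DECAY by the Combes–Thomas weighted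
coercivity argument, in K3's own currency (sums of `Re tr(XᴴY)` over the `Fin` box, no operator algebra):

* §1 pairing algebra: `hsRe_smul_sub_smul` (`Re tr((aX − bY)ᴴ(cX − dY)) = ac·S(X) + bd·S(Y) − (ad+bc)·Re tr(XᴴY)`, real `a,b,c,d`),
  `abs_hsRe_le` (`|Re tr(XᴴY)| ≤ (λS(X) + λ⁻¹S(Y))∕2`), `hsS_real_smul`, `trace_real_smul_eq_zero`;
* §2 weights: `covShift_real_smul` (`S_μ(w·Φ) = w(·+e_μ)·S_μΦ`), ★ `dirichlet_weight_identity`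
  (`Σ Re tr(∇⁺_μ(w²Φ)ᴴ ∇⁺_μΦ) = Σ S(∇⁺_μ(wΦ)) − Σ (w(x+e_μ) − w(x))²·Re tr((S_μΦ)(x)ᴴ Φ(x))`), `weight_error_le`
  (the error is `≤ 4κ·Σ_x w(x)² S(Φ x)` when `(w(x+e_μ) − w(x))² ≤ κ·w(x)w(x+e_μ)`), `exp_weight_admissible` (`w = e^{θρ}` with `ρ`
  1-Lipschitz along the links is admissible with `κ = 2(cosh θ − 1)`);
* §3 ★★ `weighted_coercivity_of_zeroForm_gap` — **COMBES–THOMAS, WEAK FORM**: at a unitary background with 0-form gap `m` on traceless fields,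
  `(m − 4κ)·Σ_x w(x)² S(Φ x) ≤ Σ_x Σ_μ Re tr((∇⁺_μ(w²Φ))(x)ᴴ (∇⁺_μΦ)(x))` for every traceless `Φ` and every admissible weight `w > 0`;
  ★★ `weighted_apriori_of_weak_poisson` — if `Φ` solves `Δ_U Φ = J` weakly on traceless fields then
  `(m − 4κ)²·Σ_x w(x)² S(Φ x) ≤ Σ_x w(x)² S(J x)` (`m > 4κ`), hence ★ `pointwise_decay_of_weak_poisson`:
  `S(Φ x₀) ≤ (m − 4κ)⁻² Σ_x (w x∕w x₀)² S(J x)` — with `w = e^{−θ d(·,x₀)}` and `J` supported at `y` this is `‖Δ⁻¹(x₀,y)‖ ≲ e^{−θ d(x₀,y)}`;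
* §4 ★★★ `ladder_weighted_apriori` — the twist-eating ladder `U = ladderField ![A, B, Γ₂, Γ₃]` on the box `ℓ₀ × ℓ₀ × L × t` (`A B = ω B A`,
  `ω` a primitive `N`-th root, `A, B, Γ₂, Γ₃` unitary): for every `θ ≥ 0` with `8(cosh θ − 1) < g := 4 sin²(π∕(Nℓ₀))`, every `ρ` that is
  1-Lipschitz along the links, every traceless weak solution of `Δ_U Φ = J`:
  `(g − 8(cosh θ − 1))²·Σ_x e^{2θρ(x)} S(Φ x) ≤ Σ_x e^{2θρ(x)} S(J x)` — NO dependence on `L, t` (K3c's gap is uniform).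

HONEST FRAMING: a tree-level (β-independent) linear estimate — the uniform exponential decay of the Gaussian covariance that a cluster expansion
of the twisted tube would consume; it is NOT that expansion; T1 (M4) 0∕1, not claimed; nothing here bears on `IRcof`, `IR`, or the Yang–Mills
mass gap (Clay: NOT proved); R4 = `BalabanLadder.UV` only.
References: J.-M. Combes, L. Thomas, Commun. Math. Phys. 34 (1973) 251; M. Aizenman, S. Warzel, *Random Operators* (2015) §10.3;
M. García Pérez, A. González-Arroyo, M. Okawa, IJMPA 29 (2014) 1445001 §3 (twist-eater spectrum).
-/

set_option autoImplicit false

noncomputable section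

open scoped Matrix
open Finset
open Literature.MathematicalPhysics.QuantumFieldTheory Literature.MathematicalPhysics.QuantumLattice

namespace Summit.QuantumFields.YangMills.Cruxes.IRcof.TwistedSlab

variable {N : ℕ} {n₀ n₁ n₂ n₃ : ℕ}

/-! ## §1 Pairing algebra with real scalars -/

section Pairing

/-- Symmetry of the real pairing (private twin of K3a's). [folklore] -/
private theorem hsRe_symm' (X Y : Matrix (Fin N) (Fin N) ℂ) : ((Xᴴ * Y).trace).re = ((Yᴴ * X).trace).re := by
  have h : Yᴴ * X = (Xᴴ * Y)ᴴ := by rw [Matrix.conjTranspose_mul, Matrix.conjTranspose_conjTranspose]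
  rw [h, Matrix.trace_conjTranspose, Complex.star_def, Complex.conj_re]

/-- Real scalars come out of the left slot: `Re tr((aX)ᴴY) = a·Re tr(XᴴY)`. [folklore] -/
theorem hsRe_real_smul_left (a : ℝ) (X Y : Matrix (Fin N) (Fin N) ℂ) :
    ((((a : ℂ) • X)ᴴ * Y).trace).re = a * ((Xᴴ * Y).trace).re := by
  rw [Matrix.conjTranspose_smul, Complex.star_def, Complex.conj_ofReal, Matrix.smul_mul, Matrix.trace_smul, smul_eq_mul,
    Complex.re_ofReal_mul]

/-- Real scalars come out of the right slot: `Re tr(Xᴴ(cY)) = c·Re tr(XᴴY)`. [folklore] -/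
theorem hsRe_real_smul_right (c : ℝ) (X Y : Matrix (Fin N) (Fin N) ℂ) :
    ((Xᴴ * ((c : ℂ) • Y)).trace).re = c * ((Xᴴ * Y).trace).re := by
  rw [Matrix.mul_smul, Matrix.trace_smul, smul_eq_mul, Complex.re_ofReal_mul]

/-- **Bilinear expansion**: `Re tr((aX − bY)ᴴ(cX − dY)) = ac·S(X) + bd·S(Y) − (ad + bc)·Re tr(XᴴY)` for real `a, b, c, d`. [folklore] -/
theorem hsRe_smul_sub_smul (a b c d : ℝ) (X Y : Matrix (Fin N) (Fin N) ℂ) :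
    (((((a : ℂ) • X - (b : ℂ) • Y))ᴴ * ((c : ℂ) • X - (d : ℂ) • Y)).trace).re =
      a * c * ((Xᴴ * X).trace).re + b * d * ((Yᴴ * Y).trace).re - (a * d + b * c) * ((Xᴴ * Y).trace).re := by
  rw [hsRe_sub_left, hsRe_sub_right, hsRe_sub_right, hsRe_real_smul_left, hsRe_real_smul_left, hsRe_real_smul_left,
    hsRe_real_smul_left, hsRe_real_smul_right, hsRe_real_smul_right, hsRe_real_smul_right, hsRe_real_smul_right,
    hsRe_symm' Y X]
  ring

/-- `S(cX) = c²·S(X)` for real `c`. [folklore] -/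
theorem hsS_real_smul (c : ℝ) (X : Matrix (Fin N) (Fin N) ℂ) :
    ((((c : ℂ) • X)ᴴ * ((c : ℂ) • X)).trace).re = c ^ 2 * ((Xᴴ * X).trace).re := by
  rw [hsRe_real_smul_left, hsRe_real_smul_right]; ring

/-- **Polarised Cauchy–Schwarz ∕ AM–GM**: `|Re tr(XᴴY)| ≤ (λ·S(X) + λ⁻¹·S(Y))∕2` for `λ > 0` (from `S(λX ∓ Y) ≥ 0`). [folklore] -/
theorem abs_hsRe_le {lam : ℝ} (hlam : 0 < lam) (X Y : Matrix (Fin N) (Fin N) ℂ) :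
    |((Xᴴ * Y).trace).re| ≤ (lam * ((Xᴴ * X).trace).re + lam⁻¹ * ((Yᴴ * Y).trace).re) / 2 := by
  have h1 := re_trace_conjTranspose_mul_self_nonneg ((lam : ℂ) • X - (1 : ℂ) • Y)
  have h2 := re_trace_conjTranspose_mul_self_nonneg ((lam : ℂ) • X - ((-1 : ℝ) : ℂ) • Y)
  have e1 := hsRe_smul_sub_smul lam 1 lam 1 X Y
  have e2 := hsRe_smul_sub_smul lam (-1) lam (-1) X Y
  push_cast at e1 e2 h1 h2
  rw [e1] at h1
  rw [e2] at h2
  have hX := re_trace_conjTranspose_mul_self_nonneg X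
  have hY := re_trace_conjTranspose_mul_self_nonneg Y
  rw [abs_le]
  constructor
  · -- from `h2`: `2λ·Re ≥ −(λ²S(X) + S(Y))`
    have : -(lam * ((Xᴴ * X).trace).re + lam⁻¹ * ((Yᴴ * Y).trace).re) / 2 ≤ ((Xᴴ * Y).trace).re := by
      rw [div_le_iff₀ (by norm_num : (0:ℝ) < 2)]
      have h := mul_le_mul_of_nonneg_left (show 0 ≤ lam * lam * ((Xᴴ * X).trace).re + 1 * ((Yᴴ * Y).trace).re +
        (lam + lam) * ((Xᴴ * Y).trace).re by nlinarith [h2]) (le_of_lt (inv_pos.2 hlam))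
      have hl : lam⁻¹ * lam = 1 := inv_mul_cancel₀ hlam.ne'
      nlinarith [hl, h]
    linarith
  · rw [le_div_iff₀ (by norm_num : (0:ℝ) < 2)]
    have h := mul_le_mul_of_nonneg_left (show 0 ≤ lam * lam * ((Xᴴ * X).trace).re + 1 * ((Yᴴ * Y).trace).re -
      (lam + lam) * ((Xᴴ * Y).trace).re by nlinarith [h1]) (le_of_lt (inv_pos.2 hlam))
    have hl : lam⁻¹ * lam = 1 := inv_mul_cancel₀ hlam.ne'
    nlinarith [hl, h]

/-- Real multiples of traceless matrices are traceless. [folklore] -/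
theorem trace_real_smul_eq_zero (c : ℝ) {X : Matrix (Fin N) (Fin N) ℂ} (hX : X.trace = 0) : ((c : ℂ) • X).trace = 0 := by
  rw [Matrix.trace_smul, hX, smul_zero]

end Pairing

/-! ## §2 Weights: the Dirichlet form of `w²Φ` against `Φ` versus the energy of `wΦ` -/

section Weights

variable {U : FinTorusSite n₀ n₁ n₂ n₃ × Fin 4 → Matrix (Fin N) (Fin N) ℂ}

/-- The covariant shift is `ℂ`-linear in the field, sitewise: `S_μ(c·Φ)(x) = c(x+e_μ)·(S_μΦ)(x)`. [folklore] -/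
theorem covShift_real_smul (μ : Fin 4) (c : FinTorusSite n₀ n₁ n₂ n₃ → ℝ) (Φ : FinTorusSite n₀ n₁ n₂ n₃ → Matrix (Fin N) (Fin N) ℂ)
    (x : FinTorusSite n₀ n₁ n₂ n₃) :
    covShift U μ (fun y => ((c y : ℝ) : ℂ) • Φ y) x = ((c (x.shift μ) : ℝ) : ℂ) • covShift U μ Φ x := by
  simp only [covShift_apply, Matrix.mul_smul, Matrix.smul_mul]

/-- Pointwise identity behind Combes–Thomas: with `w₊ = w(x+e_μ)`, `w = w(x)`, `P = (S_μΦ)(x)`, `Q = Φ(x)`: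
`Re tr((w₊²P − w²Q)ᴴ(P − Q)) = S(w₊P − wQ) − (w₊ − w)²·Re tr(PᴴQ)`. [cite: CombesThomas1973] -/
theorem hsRe_weight_pointwise (wp w : ℝ) (P Q : Matrix (Fin N) (Fin N) ℂ) :
    (((((wp ^ 2 : ℝ) : ℂ) • P - ((w ^ 2 : ℝ) : ℂ) • Q)ᴴ * (P - Q)).trace).re =
      (((((wp : ℂ) • P - (w : ℂ) • Q))ᴴ * ((wp : ℂ) • P - (w : ℂ) • Q)).trace).re - (wp - w) ^ 2 * ((Pᴴ * Q).trace).re := by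
  have e1 := hsRe_smul_sub_smul (wp ^ 2) (w ^ 2) 1 1 P Q
  have e2 := hsRe_smul_sub_smul wp w wp w P Q
  push_cast at e1 e2 ⊢
  rw [one_smul, one_smul] at e1
  rw [e1, e2]
  ring

/-- ★ **The weighted Dirichlet identity**: for a real weight `w` and any field `Φ`,
`Σ_x Σ_μ Re tr((∇⁺_μ(w²Φ))(x)ᴴ (∇⁺_μΦ)(x)) = Σ_x Σ_μ S((∇⁺_μ(wΦ))(x)) − Σ_x Σ_μ (w(x+e_μ) − w(x))²·Re tr(((S_μΦ)(x))ᴴ Φ(x))`.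
[cite: CombesThomas1973] [cite: AizenmanWarzel2015, §10.3] -/
theorem dirichlet_weight_identity (w : FinTorusSite n₀ n₁ n₂ n₃ → ℝ) (Φ : FinTorusSite n₀ n₁ n₂ n₃ → Matrix (Fin N) (Fin N) ℂ) :
    ∑ x, ∑ μ, (((covDeriv U μ (fun y => ((w y ^ 2 : ℝ) : ℂ) • Φ y) x)ᴴ * covDeriv U μ Φ x).trace).re =
      ∑ x, ∑ μ, (((covDeriv U μ (fun y => ((w y : ℝ) : ℂ) • Φ y) x)ᴴ * covDeriv U μ (fun y => ((w y : ℝ) : ℂ) • Φ y) x).trace).re -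
        ∑ x, ∑ μ, (w (x.shift μ) - w x) ^ 2 * (((covShift U μ Φ x)ᴴ * Φ x).trace).re := by
  rw [← Finset.sum_sub_distrib]
  refine Finset.sum_congr rfl fun x _ => ?_
  rw [← Finset.sum_sub_distrib]
  refine Finset.sum_congr rfl fun μ _ => ?_
  simp only [covDeriv, covShift_real_smul]
  exact hsRe_weight_pointwise (w (x.shift μ)) (w x) (covShift U μ Φ x) (Φ x)

variable (hU : ∀ e, U e ∈ Matrix.unitaryGroup (Fin N) ℂ)
include hU

/-- The covariant shift is a sitewise isometry: `S((S_μΦ)(x)) = S(Φ(x+e_μ))`. [folklore] -/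
theorem hsS_covShift_apply (μ : Fin 4) (Φ : FinTorusSite n₀ n₁ n₂ n₃ → Matrix (Fin N) (Fin N) ℂ) (x : FinTorusSite n₀ n₁ n₂ n₃) :
    (((covShift U μ Φ x)ᴴ * covShift U μ Φ x).trace).re = (((Φ (x.shift μ))ᴴ * Φ (x.shift μ)).trace).re := by
  have h1 : (U (x, μ))ᴴ * U (x, μ) = 1 := (hU (x, μ)).1
  rw [covShift_apply]
  exact hsRe_conj h1 _ _

/-- **The weight error is small**: if `(w(x+e_μ) − w(x))² ≤ κ·w(x)·w(x+e_μ)` for all links (with `w > 0`), then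
`|Σ_x Σ_μ (w(x+e_μ) − w(x))²·Re tr((S_μΦ)(x)ᴴΦ(x))| ≤ 4κ·Σ_x w(x)² S(Φ(x))`. [cite: CombesThomas1973] [cite: AizenmanWarzel2015, §10.3] -/
theorem weight_error_le {w : FinTorusSite n₀ n₁ n₂ n₃ → ℝ} (hw : ∀ x, 0 < w x) {κ : ℝ}
    (hκ : ∀ x μ, (w (x.shift μ) - w x) ^ 2 ≤ κ * (w x * w (x.shift μ)))
    (Φ : FinTorusSite n₀ n₁ n₂ n₃ → Matrix (Fin N) (Fin N) ℂ) :
    |∑ x, ∑ μ, (w (x.shift μ) - w x) ^ 2 * (((covShift U μ Φ x)ᴴ * Φ x).trace).re| ≤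
      4 * κ * ∑ x, w x ^ 2 * (((Φ x)ᴴ * Φ x).trace).re := by
  -- pointwise: `(w₊ − w)²|Re tr(PᴴQ)| ≤ (κ/2)(w₊² S(P) + w² S(Q))`, `S(P) = S(Φ(x+e_μ))`
  have hpt : ∀ x μ, |(w (x.shift μ) - w x) ^ 2 * (((covShift U μ Φ x)ᴴ * Φ x).trace).re| ≤
      κ / 2 * (w (x.shift μ) ^ 2 * (((Φ (x.shift μ))ᴴ * Φ (x.shift μ)).trace).re + w x ^ 2 * (((Φ x)ᴴ * Φ x).trace).re) := by
    intro x μ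
    have hwx := hw x
    have hwp := hw (x.shift μ)
    have hlam : 0 < w (x.shift μ) / w x := div_pos hwp hwx
    have hcs := abs_hsRe_le hlam (covShift U μ Φ x) (Φ x)
    rw [hsS_covShift_apply hU] at hcs
    have hSP := re_trace_conjTranspose_mul_self_nonneg (Φ (x.shift μ))
    have hSQ := re_trace_conjTranspose_mul_self_nonneg (Φ x)
    rw [abs_mul, abs_of_nonneg (sq_nonneg _)]
    have hk := hκ x μ
    -- `(w₊ − w)² · (λ S_P + λ⁻¹ S_Q)/2 ≤ κ w w₊ (λ S_P + λ⁻¹ S_Q)/2 = (κ/2)(w₊² S_P + w² S_Q)`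
    have hinv : (w (x.shift μ) / w x)⁻¹ = w x / w (x.shift μ) := by rw [inv_div]
    rw [hinv] at hcs
    have hnn : 0 ≤ (w (x.shift μ) / w x * (((Φ (x.shift μ))ᴴ * Φ (x.shift μ)).trace).re +
        w x / w (x.shift μ) * (((Φ x)ᴴ * Φ x).trace).re) / 2 := by positivity
    calc (w (x.shift μ) - w x) ^ 2 * |(((covShift U μ Φ x)ᴴ * Φ x).trace).re|
        ≤ κ * (w x * w (x.shift μ)) * ((w (x.shift μ) / w x * (((Φ (x.shift μ))ᴴ * Φ (x.shift μ)).trace).re +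
            w x / w (x.shift μ) * (((Φ x)ᴴ * Φ x).trace).re) / 2) :=
          mul_le_mul hk hcs (abs_nonneg _) ((sq_nonneg _).trans hk)
      _ = κ / 2 * (w (x.shift μ) ^ 2 * (((Φ (x.shift μ))ᴴ * Φ (x.shift μ)).trace).re +
            w x ^ 2 * (((Φ x)ᴴ * Φ x).trace).re) := by
          field_simp
  -- sum the pointwise bounds; each of the two families sums to `Σ_x w² S(Φ)` (reindex the first along the shift)
  calc |∑ x, ∑ μ, (w (x.shift μ) - w x) ^ 2 * (((covShift U μ Φ x)ᴴ * Φ x).trace).re|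
      ≤ ∑ x, ∑ μ, |(w (x.shift μ) - w x) ^ 2 * (((covShift U μ Φ x)ᴴ * Φ x).trace).re| :=
        (Finset.abs_sum_le_sum_abs _ _).trans (Finset.sum_le_sum fun x _ => Finset.abs_sum_le_sum_abs _ _)
    _ ≤ ∑ x, ∑ μ, κ / 2 * (w (x.shift μ) ^ 2 * (((Φ (x.shift μ))ᴴ * Φ (x.shift μ)).trace).re +
          w x ^ 2 * (((Φ x)ᴴ * Φ x).trace).re) :=
        Finset.sum_le_sum fun x _ => Finset.sum_le_sum fun μ _ => hpt x μ
    _ = κ / 2 * ∑ μ : Fin 4, (∑ x : FinTorusSite n₀ n₁ n₂ n₃, w (x.shift μ) ^ 2 * (((Φ (x.shift μ))ᴴ * Φ (x.shift μ)).trace).re +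
          ∑ x : FinTorusSite n₀ n₁ n₂ n₃, w x ^ 2 * (((Φ x)ᴴ * Φ x).trace).re) := by
        rw [Finset.sum_comm, Finset.mul_sum]
        refine Finset.sum_congr rfl fun μ _ => ?_
        rw [← Finset.sum_add_distrib, Finset.mul_sum]
    _ = κ / 2 * ∑ _μ : Fin 4, (2 * ∑ x : FinTorusSite n₀ n₁ n₂ n₃, w x ^ 2 * (((Φ x)ᴴ * Φ x).trace).re) := by
        congr 1
        refine Finset.sum_congr rfl fun μ _ => ?_
        rw [sum_shift (fun y => w y ^ 2 * (((Φ y)ᴴ * Φ y).trace).re) μ]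
        ring
    _ = 4 * κ * ∑ x, w x ^ 2 * (((Φ x)ᴴ * Φ x).trace).re := by
        rw [Finset.sum_const, Finset.card_univ, Fintype.card_fin]
        ring

omit hU in
/-- **Exponential weights are admissible**: if `ρ` is 1-Lipschitz along the links, `|ρ(x+e_μ) − ρ(x)| ≤ 1`, and `θ ≥ 0`, then
`w = e^{θρ}` satisfies `(w(x+e_μ) − w(x))² ≤ 2(cosh θ − 1)·w(x)w(x+e_μ)`. [cite: CombesThomas1973] -/
theorem exp_weight_admissible {ρ : FinTorusSite n₀ n₁ n₂ n₃ → ℝ} (hρ : ∀ x μ, |ρ (x.shift μ) - ρ x| ≤ 1) {θ : ℝ} (hθ : 0 ≤ θ)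
    (x : FinTorusSite n₀ n₁ n₂ n₃) (μ : Fin 4) :
    (Real.exp (θ * ρ (x.shift μ)) - Real.exp (θ * ρ x)) ^ 2 ≤
      2 * (Real.cosh θ - 1) * (Real.exp (θ * ρ x) * Real.exp (θ * ρ (x.shift μ))) := by
  set s := θ * (ρ (x.shift μ) - ρ x) with hs
  have hsθ : |s| ≤ |θ| := by
    rw [hs, abs_mul, abs_of_nonneg hθ]
    calc θ * |ρ (x.shift μ) - ρ x| ≤ θ * 1 := mul_le_mul_of_nonneg_left (hρ x μ) hθ
      _ = θ := mul_one θ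
  have hcosh : Real.cosh s ≤ Real.cosh θ := Real.cosh_le_cosh.2 hsθ
  have hsplit : Real.exp (θ * ρ (x.shift μ)) = Real.exp (θ * ρ x) * Real.exp s := by
    rw [← Real.exp_add]; congr 1; rw [hs]; ring
  rw [hsplit]
  have hEs := Real.exp_pos s
  have hprod : Real.exp s * Real.exp (-s) = 1 := by rw [← Real.exp_add, add_neg_cancel, Real.exp_zero]
  -- `(e^s − 1)² ≤ 2(cosh θ − 1)·e^s` ⟸ `e^s + e^{−s} ≤ 2 cosh θ`
  have hsum : Real.exp s + Real.exp (-s) ≤ 2 * Real.cosh θ := by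
    rw [Real.cosh_eq s] at hcosh; linarith
  have h3 := mul_le_mul_of_nonneg_left hsum hEs.le
  have key : (Real.exp s - 1) ^ 2 ≤ 2 * (Real.cosh θ - 1) * Real.exp s := by nlinarith [h3, hprod]
  have h0 : 0 ≤ Real.exp (θ * ρ x) ^ 2 := sq_nonneg _
  calc (Real.exp (θ * ρ x) * Real.exp s - Real.exp (θ * ρ x)) ^ 2 = Real.exp (θ * ρ x) ^ 2 * (Real.exp s - 1) ^ 2 := by ring
    _ ≤ Real.exp (θ * ρ x) ^ 2 * (2 * (Real.cosh θ - 1) * Real.exp s) := mul_le_mul_of_nonneg_left key h0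
    _ = 2 * (Real.cosh θ - 1) * (Real.exp (θ * ρ x) * (Real.exp (θ * ρ x) * Real.exp s)) := by ring

end Weights

/-! ## §3 Combes–Thomas in weak form at a background with a 0-form gap -/

section CombesThomas

variable {U : FinTorusSite n₀ n₁ n₂ n₃ × Fin 4 → Matrix (Fin N) (Fin N) ℂ} (hU : ∀ e, U e ∈ Matrix.unitaryGroup (Fin N) ℂ)
include hU

/-- ★★ **COMBES–THOMAS, WEAK FORM (weighted coercivity).**  Let the unitary background `U` have a 0-form gap `m` on traceless fields
(`m·Σ S(Φ) ≤ Σ_x Σ_μ S(∇⁺_μΦ)`), and let `w > 0` be a weight with `(w(x+e_μ) − w(x))² ≤ κ·w(x)w(x+e_μ)` on every link.  Then for every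
traceless `Φ`: `(m − 4κ)·Σ_x w(x)² S(Φ x) ≤ Σ_x Σ_μ Re tr((∇⁺_μ(w²Φ))(x)ᴴ (∇⁺_μΦ)(x))`. [cite: CombesThomas1973] [cite: AizenmanWarzel2015, §10.3] -/
theorem weighted_coercivity_of_zeroForm_gap {m : ℝ}
    (hgap : ∀ Φ : FinTorusSite n₀ n₁ n₂ n₃ → Matrix (Fin N) (Fin N) ℂ, (∀ x, (Φ x).trace = 0) →
      m * ∑ x, (((Φ x)ᴴ * Φ x).trace).re ≤ ∑ x, ∑ μ, (((covDeriv U μ Φ x)ᴴ * covDeriv U μ Φ x).trace).re)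
    {w : FinTorusSite n₀ n₁ n₂ n₃ → ℝ} (hw : ∀ x, 0 < w x) {κ : ℝ}
    (hκ : ∀ x μ, (w (x.shift μ) - w x) ^ 2 ≤ κ * (w x * w (x.shift μ)))
    (Φ : FinTorusSite n₀ n₁ n₂ n₃ → Matrix (Fin N) (Fin N) ℂ) (htr : ∀ x, (Φ x).trace = 0) :
    (m - 4 * κ) * ∑ x, w x ^ 2 * (((Φ x)ᴴ * Φ x).trace).re ≤
      ∑ x, ∑ μ, (((covDeriv U μ (fun y => ((w y ^ 2 : ℝ) : ℂ) • Φ y) x)ᴴ * covDeriv U μ Φ x).trace).re := by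
  rw [dirichlet_weight_identity w Φ]
  -- the gap applied to the traceless field `wΦ`, whose energy is `Σ w² S(Φ)`
  have hgapw := hgap (fun y => ((w y : ℝ) : ℂ) • Φ y) fun x => trace_real_smul_eq_zero (w x) (htr x)
  have henergy : ∑ x, (((((w x : ℝ) : ℂ) • Φ x)ᴴ * (((w x : ℝ) : ℂ) • Φ x)).trace).re = ∑ x, w x ^ 2 * (((Φ x)ᴴ * Φ x).trace).re :=
    Finset.sum_congr rfl fun x _ => hsS_real_smul (w x) (Φ x)
  rw [henergy] at hgapw
  have herr := weight_error_le hU hw hκ Φ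
  have herr' := (abs_le.1 herr).2
  nlinarith [hgapw, herr']

/-- ★★ **A-PRIORI WEIGHTED ESTIMATE FOR THE COVARIANT POISSON EQUATION.**  If, in addition, `Φ` is a traceless weak solution of
`Δ_U Φ = J` on traceless test fields (`Σ Re tr((∇⁺_μχ)ᴴ ∇⁺_μΦ) = Σ Re tr(χᴴJ)` for every traceless `χ`) and `m > 4κ`, then
`(m − 4κ)²·Σ_x w(x)² S(Φ x) ≤ Σ_x w(x)² S(J x)`. [cite: CombesThomas1973] [cite: AizenmanWarzel2015, §10.3] -/
theorem weighted_apriori_of_weak_poisson {m : ℝ}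
    (hgap : ∀ Φ : FinTorusSite n₀ n₁ n₂ n₃ → Matrix (Fin N) (Fin N) ℂ, (∀ x, (Φ x).trace = 0) →
      m * ∑ x, (((Φ x)ᴴ * Φ x).trace).re ≤ ∑ x, ∑ μ, (((covDeriv U μ Φ x)ᴴ * covDeriv U μ Φ x).trace).re)
    {w : FinTorusSite n₀ n₁ n₂ n₃ → ℝ} (hw : ∀ x, 0 < w x) {κ : ℝ}
    (hκ : ∀ x μ, (w (x.shift μ) - w x) ^ 2 ≤ κ * (w x * w (x.shift μ))) (hmκ : 4 * κ < m)
    (Φ J : FinTorusSite n₀ n₁ n₂ n₃ → Matrix (Fin N) (Fin N) ℂ) (htr : ∀ x, (Φ x).trace = 0)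
    (hweak : ∀ χ : FinTorusSite n₀ n₁ n₂ n₃ → Matrix (Fin N) (Fin N) ℂ, (∀ x, (χ x).trace = 0) →
      ∑ x, ∑ μ, (((covDeriv U μ χ x)ᴴ * covDeriv U μ Φ x).trace).re = ∑ x, (((χ x)ᴴ * J x).trace).re) :
    (m - 4 * κ) ^ 2 * ∑ x, w x ^ 2 * (((Φ x)ᴴ * Φ x).trace).re ≤ ∑ x, w x ^ 2 * (((J x)ᴴ * J x).trace).re := by
  set δ := m - 4 * κ with hδ
  have hδpos : 0 < δ := by rw [hδ]; linarith
  set W := ∑ x, w x ^ 2 * (((Φ x)ᴴ * Φ x).trace).re with hW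
  set WJ := ∑ x, w x ^ 2 * (((J x)ᴴ * J x).trace).re with hWJ
  have hcoer := weighted_coercivity_of_zeroForm_gap hU hgap hw hκ Φ htr
  rw [hweak _ (fun x => trace_real_smul_eq_zero (w x ^ 2) (htr x))] at hcoer
  -- `Σ Re tr((w²Φ)ᴴJ) = Σ w² Re tr(ΦᴴJ) ≤ Σ w² (δ S(Φ) + δ⁻¹ S(J))/2 = (δ W + δ⁻¹ WJ)/2`
  have hpair : ∑ x, ((((((w x ^ 2 : ℝ) : ℂ) • Φ x))ᴴ * J x).trace).re ≤ (δ * W + δ⁻¹ * WJ) / 2 := by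
    calc ∑ x, ((((((w x ^ 2 : ℝ) : ℂ) • Φ x))ᴴ * J x).trace).re = ∑ x, w x ^ 2 * (((Φ x)ᴴ * J x).trace).re :=
          Finset.sum_congr rfl fun x _ => hsRe_real_smul_left _ _ _
      _ ≤ ∑ x, w x ^ 2 * ((δ * (((Φ x)ᴴ * Φ x).trace).re + δ⁻¹ * (((J x)ᴴ * J x).trace).re) / 2) :=
          Finset.sum_le_sum fun x _ => mul_le_mul_of_nonneg_left ((le_abs_self _).trans (abs_hsRe_le hδpos _ _)) (sq_nonneg _)
      _ = (δ * W + δ⁻¹ * WJ) / 2 := by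
          rw [hW, hWJ, Finset.mul_sum, Finset.mul_sum, ← Finset.sum_add_distrib, Finset.sum_div]
          refine Finset.sum_congr rfl fun x _ => ?_
          ring
  have hmain : δ * W ≤ (δ * W + δ⁻¹ * WJ) / 2 := hcoer.trans hpair
  have h1 : δ * W ≤ δ⁻¹ * WJ := by linarith
  have h2 := mul_le_mul_of_nonneg_left h1 hδpos.le
  have h3 : δ * (δ⁻¹ * WJ) = WJ := by rw [← mul_assoc, mul_inv_cancel₀ hδpos.ne', one_mul]
  calc δ ^ 2 * W = δ * (δ * W) := by ring
    _ ≤ δ * (δ⁻¹ * WJ) := h2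
    _ = WJ := h3

/-- ★ **Pointwise decay**: under the same hypotheses, at every site `x₀`,
`w(x₀)²·S(Φ x₀) ≤ (m − 4κ)⁻²·Σ_x w(x)² S(J x)` — with `w = e^{−θ d(·,x₀)}` and `J` supported at one site `y` this reads
`S(Φ x₀) ≤ (m−4κ)⁻² e^{−2θ d(y,x₀)} S(J y)`: exponential decay of the Green's function. [cite: CombesThomas1973] [cite: AizenmanWarzel2015, §10.3] -/
theorem pointwise_decay_of_weak_poisson {m : ℝ}
    (hgap : ∀ Φ : FinTorusSite n₀ n₁ n₂ n₃ → Matrix (Fin N) (Fin N) ℂ, (∀ x, (Φ x).trace = 0) →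
      m * ∑ x, (((Φ x)ᴴ * Φ x).trace).re ≤ ∑ x, ∑ μ, (((covDeriv U μ Φ x)ᴴ * covDeriv U μ Φ x).trace).re)
    {w : FinTorusSite n₀ n₁ n₂ n₃ → ℝ} (hw : ∀ x, 0 < w x) {κ : ℝ}
    (hκ : ∀ x μ, (w (x.shift μ) - w x) ^ 2 ≤ κ * (w x * w (x.shift μ))) (hmκ : 4 * κ < m)
    (Φ J : FinTorusSite n₀ n₁ n₂ n₃ → Matrix (Fin N) (Fin N) ℂ) (htr : ∀ x, (Φ x).trace = 0)
    (hweak : ∀ χ : FinTorusSite n₀ n₁ n₂ n₃ → Matrix (Fin N) (Fin N) ℂ, (∀ x, (χ x).trace = 0) →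
      ∑ x, ∑ μ, (((covDeriv U μ χ x)ᴴ * covDeriv U μ Φ x).trace).re = ∑ x, (((χ x)ᴴ * J x).trace).re)
    (x₀ : FinTorusSite n₀ n₁ n₂ n₃) :
    w x₀ ^ 2 * (((Φ x₀)ᴴ * Φ x₀).trace).re ≤ ((m - 4 * κ) ^ 2)⁻¹ * ∑ x, w x ^ 2 * (((J x)ᴴ * J x).trace).re := by
  have h := weighted_apriori_of_weak_poisson hU hgap hw hκ hmκ Φ J htr hweak
  have hmk : 0 < m - 4 * κ := by linarith
  have hδ : 0 < (m - 4 * κ) ^ 2 := by positivity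
  have hsingle : w x₀ ^ 2 * (((Φ x₀)ᴴ * Φ x₀).trace).re ≤ ∑ x, w x ^ 2 * (((Φ x)ᴴ * Φ x).trace).re :=
    Finset.single_le_sum (fun x _ => mul_nonneg (sq_nonneg _) (re_trace_conjTranspose_mul_self_nonneg (Φ x))) (Finset.mem_univ x₀)
  rw [le_inv_mul_iff₀ hδ]
  exact (mul_le_mul_of_nonneg_left hsingle hδ.le).trans h

end CombesThomas

/-! ## §4 The twist-eating ladder: decay constants uniform in the long extents `L, t` -/

section Ladder

variable [NeZero N] {A B : Matrix (Fin N) (Fin N) ℂ} {ω : ℂ} {m : ℕ}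

/-- ★★★ **UNIFORM PROPAGATOR DECAY ON THE TWISTED TUBE (a-priori form).**  At the twist-eating ladder `U = ladderField ![A, B, Γ₂, Γ₃]` on the box
`(m+1) × (m+1) × n₂ × n₃` (`A, B, Γ₂, Γ₃` unitary, `A B = ω B A`, `ω` a primitive `N`-th root of unity): for every `θ ≥ 0` with
`8(cosh θ − 1) < g := 4 sin²(π∕(N(m+1)))`, every `ρ` 1-Lipschitz along the links, and every traceless weak solution of `Δ_U Φ = J`,
`(g − 8(cosh θ − 1))² · Σ_x e^{2θρ(x)} S(Φ x) ≤ Σ_x e^{2θρ(x)} S(J x)`.  The constants see `N, m, θ` only — NOT `n₂ = L`, `n₃ = t`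
(K3c `zeroForm_gap_ladder` is uniform in the long extents). [cite: CombesThomas1973] [cite: GarciaperezGonzalezarroyoOkawa2014, §3] -/
theorem ladder_weighted_apriori (hAu : A ∈ Matrix.unitaryGroup (Fin N) ℂ) (hBu : B ∈ Matrix.unitaryGroup (Fin N) ℂ)
    (hω : IsPrimitiveRoot ω N) (hAB : A * B = ω • (B * A)) {Γ₂ Γ₃ : Matrix (Fin N) (Fin N) ℂ}
    (hΓ₂ : Γ₂ ∈ Matrix.unitaryGroup (Fin N) ℂ) (hΓ₃ : Γ₃ ∈ Matrix.unitaryGroup (Fin N) ℂ)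
    {θ : ℝ} (hθ : 0 ≤ θ) (hθg : 8 * (Real.cosh θ - 1) < 4 * Real.sin (Real.pi / ((N : ℝ) * (m + 1 : ℕ))) ^ 2)
    {ρ : FinTorusSite (m + 1) (m + 1) n₂ n₃ → ℝ} (hρ : ∀ x μ, |ρ (x.shift μ) - ρ x| ≤ 1)
    (Φ J : FinTorusSite (m + 1) (m + 1) n₂ n₃ → Matrix (Fin N) (Fin N) ℂ) (htr : ∀ x, (Φ x).trace = 0)
    (hweak : ∀ χ : FinTorusSite (m + 1) (m + 1) n₂ n₃ → Matrix (Fin N) (Fin N) ℂ, (∀ x, (χ x).trace = 0) →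
      ∑ x, ∑ μ, (((covDeriv (ladderField ![A, B, Γ₂, Γ₃]) μ χ x)ᴴ * covDeriv (ladderField ![A, B, Γ₂, Γ₃]) μ Φ x).trace).re =
        ∑ x, (((χ x)ᴴ * J x).trace).re) :
    (4 * Real.sin (Real.pi / ((N : ℝ) * (m + 1 : ℕ))) ^ 2 - 8 * (Real.cosh θ - 1)) ^ 2 *
        ∑ x, Real.exp (θ * ρ x) ^ 2 * (((Φ x)ᴴ * Φ x).trace).re ≤
      ∑ x, Real.exp (θ * ρ x) ^ 2 * (((J x)ᴴ * J x).trace).re := by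
  have hΓ : ∀ μ : Fin 4, (![A, B, Γ₂, Γ₃] : Fin 4 → Matrix (Fin N) (Fin N) ℂ) μ ∈ Matrix.unitaryGroup (Fin N) ℂ := fun μ => by
    fin_cases μ
    · simpa using hAu
    · simpa using hBu
    · simpa using hΓ₂
    · simpa using hΓ₃
  have hU : ∀ e : FinTorusSite (m + 1) (m + 1) n₂ n₃ × Fin 4, ladderField ![A, B, Γ₂, Γ₃] e ∈ Matrix.unitaryGroup (Fin N) ℂ :=
    ladderField_mem_unitaryGroup hΓ
  have hgap := fun (Ψ : FinTorusSite (m + 1) (m + 1) n₂ n₃ → Matrix (Fin N) (Fin N) ℂ) (hΨ : ∀ x, (Ψ x).trace = 0) =>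
    zeroForm_gap_ladder (n₂ := n₂) (n₃ := n₃) hAu hBu hω hAB Γ₂ Γ₃ Ψ hΨ
  have hκ := fun x μ => exp_weight_admissible (n₀ := m + 1) (n₁ := m + 1) (n₂ := n₂) (n₃ := n₃) hρ hθ x μ
  have h := weighted_apriori_of_weak_poisson hU hgap (w := fun x => Real.exp (θ * ρ x)) (fun x => Real.exp_pos (θ * ρ x))
    (κ := 2 * (Real.cosh θ - 1)) hκ (by linarith) Φ J htr hweak
  have e : 4 * Real.sin (Real.pi / ((N : ℝ) * (m + 1 : ℕ))) ^ 2 - 4 * (2 * (Real.cosh θ - 1)) =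
      4 * Real.sin (Real.pi / ((N : ℝ) * (m + 1 : ℕ))) ^ 2 - 8 * (Real.cosh θ - 1) := by ring
  rw [e] at h
  exact h

end Ladder

end Summit.QuantumFields.YangMills.Cruxes.IRcof.TwistedSlab

end
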